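import Summits.Ventures.HodgeRepro2.T5HeckeGeneratorTransport

/-!
# Transport of a three-term relation between double-coset operators along algebra isomorphisms

Tier-5 support N3 / §G-N4.2 (seat p3, gen 77). The tree recursion `T₁ T_{n+1} = T_{n+2} + (q − 1) T_{n+1} + q⁴ Tₙ`
of the Satake chain (files 192 / 203 / 207) is an identity in `H(U(J₃(u₀)), K_U)`; to read it on the record's own
pair one applies the algebra isomorphism `H(U(J₃(u₀)), K_U) ≃ₐ[k] H(U(1 ⊗ H), K_v)` of file 232 and identifies the
images of the cells `T_{aₙ}` with double-coset operators of the record's group. The three generic lemmas: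

* `cast_doubleCosetOp` — the cast along an equality of subgroups (`h ▸ AlgEquiv.refl`, file 232's `hcast`) sends
  `T_g` to `T_g`;
* `heckeAlgebraEquivOfMulEquiv_symm_doubleCosetOp` — `ε⁻¹(T_{g'}) = T_{φ⁻¹ g'}` (T5-144 read backwards);
* **`three_term_of_map`** — an algebra isomorphism `e` with `e (t n) = s n` carries `t i * t j = t l + a • t j + b • t m`
  to the same relation on `s`;
* **`composite_doubleCosetOp`** — the composite `ε₀⁻¹ ∘ cast ∘ E₁` (file 232's shape) sends `T_{a n}` to `T_{φ⁻¹ (b n)}`.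

§8(d): uses an L-value-free non-vanishing device: NO.
-/

open MulAction
open Summit.Ventures.HodgeRepro2.T5HeckePermutationModule Summit.Ventures.HodgeRepro2.T5HeckeDoubleCoset
  Summit.Ventures.HodgeRepro2.T5HeckeIsomorphismTransport Summit.Ventures.HodgeRepro2.T5HeckeIsomorphismTransportCells
  Summit.Ventures.HodgeRepro2.T5HeckeGeneratorTransport

namespace Summit.Ventures.HodgeRepro2.T5HeckeRecurrenceTransport

section Transport

variable {G : Type*} [Group G] (k : Type*) [Field k]

/-- The cast along an equality of subgroups sends `T_g` to `T_g`. -/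
theorem cast_doubleCosetOp {K₁ K₂ : Subgroup G} (h : K₁ = K₂) (g : G) [Finite (orbit K₁ (g : G ⧸ K₁))]
    [Finite (orbit K₂ (g : G ⧸ K₂))] :
    (h ▸ AlgEquiv.refl : heckeAlgebra k K₁ ≃ₐ[k] heckeAlgebra k K₂) (doubleCosetOp k K₁ g) =
      doubleCosetOp k K₂ g := by
  subst h
  rfl

variable {G' : Type*} [Group G'] (φ : G ≃* G') {K : Subgroup G} {K' : Subgroup G'}

/-- `ε⁻¹(T_{g'}) = T_{φ⁻¹ g'}` for `ε = heckeAlgebraEquivOfMulEquiv k φ hK` (T5-144 read backwards). -/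
theorem heckeAlgebraEquivOfMulEquiv_symm_doubleCosetOp (hK : ∀ g : G, g ∈ K ↔ φ g ∈ K') (g' : G')
    [Finite (orbit K' (g' : G' ⧸ K'))] [Finite (orbit K ((φ.symm g' : G) : G ⧸ K))]
    [Finite (orbit K' ((φ (φ.symm g') : G') : G' ⧸ K'))] :
    (heckeAlgebraEquivOfMulEquiv k φ hK).symm (doubleCosetOp k K' g') = doubleCosetOp k K (φ.symm g') := by
  have h1 : heckeAlgebraEquivOfMulEquiv k φ hK (doubleCosetOp k K (φ.symm g')) = doubleCosetOp k K' g' := by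
    rw [heckeAlgebraEquivOfMulEquiv_doubleCosetOp k φ hK (φ.symm g')]
    exact doubleCosetOp_congr k K' (φ.apply_symm_apply g')
  rw [← h1, AlgEquiv.symm_apply_apply]

end Transport

section ThreeTerm

variable {k A B : Type*} [CommSemiring k] [Semiring A] [Semiring B] [Algebra k A] [Algebra k B]

/-- **A three-term relation is carried by an algebra isomorphism**: if `e (t n) = s n` for all `n` and
`t i * t j = t l + a • t j + b • t m`, then `s i * s j = s l + a • s j + b • s m`. -/
theorem three_term_of_map (e : A ≃ₐ[k] B) (t : ℕ → A) (s : ℕ → B) (hs : ∀ n, e (t n) = s n) {a b : k}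
    {i j l m : ℕ} (h : t i * t j = t l + a • t j + b • t m) : s i * s j = s l + a • s j + b • s m := by
  simp only [← hs]
  rw [← map_mul, h, map_add, map_add, map_smul, map_smul]

end ThreeTerm

section Composite

variable {G₁ G₂ G₃ : Type*} [Group G₁] [Group G₂] [Group G₃] (k : Type*) [Field k]

/-- **The composite transport of a family of double-coset operators**: with `E₁ : H(G₁, K₁) ≃ₐ[k] H(G₂, K₂)` sending
`T_{a n}` to `T_{b n}`, the cast along `K₂ = K₂'`, and `ε₀⁻¹` for `ε₀ = heckeAlgebraEquivOfMulEquiv k φ hK` with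
`φ : G₃ ≃* G₂`, the composite sends `T_{a n}` to `T_{φ⁻¹ (b n)}`. -/
theorem composite_doubleCosetOp {K₁ : Subgroup G₁} {K₂ K₂' : Subgroup G₂} {K₃ : Subgroup G₃}
    (E₁ : heckeAlgebra k K₁ ≃ₐ[k] heckeAlgebra k K₂) (hK₂ : K₂ = K₂') (φ : G₃ ≃* G₂)
    (hK : ∀ g : G₃, g ∈ K₃ ↔ φ g ∈ K₂') (a : ℕ → G₁) (b : ℕ → G₂)
    (hA : ∀ n, Finite (orbit K₁ ((a n : G₁) : G₁ ⧸ K₁))) (hB : ∀ n, Finite (orbit K₂ ((b n : G₂) : G₂ ⧸ K₂)))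
    (hB' : ∀ n, Finite (orbit K₂' ((b n : G₂) : G₂ ⧸ K₂')))
    (hB'' : ∀ n, Finite (orbit K₂' ((φ (φ.symm (b n)) : G₂) : G₂ ⧸ K₂')))
    (hC : ∀ n, Finite (orbit K₃ ((φ.symm (b n) : G₃) : G₃ ⧸ K₃)))
    (hE₁ : ∀ n, E₁ (@doubleCosetOp G₁ _ k _ K₁ (a n) (hA n)) = @doubleCosetOp G₂ _ k _ K₂ (b n) (hB n)) (n : ℕ) :
    (E₁.trans ((hK₂ ▸ AlgEquiv.refl : heckeAlgebra k K₂ ≃ₐ[k] heckeAlgebra k K₂').trans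
        (heckeAlgebraEquivOfMulEquiv k φ hK).symm)) (@doubleCosetOp G₁ _ k _ K₁ (a n) (hA n)) =
      @doubleCosetOp G₃ _ k _ K₃ (φ.symm (b n)) (hC n) := by
  haveI := hB' n
  haveI := hB'' n
  haveI := hC n
  rw [AlgEquiv.trans_apply, AlgEquiv.trans_apply, hE₁ n, cast_doubleCosetOp k hK₂ (b n),
    heckeAlgebraEquivOfMulEquiv_symm_doubleCosetOp k φ hK (b n)]

end Composite

end Summit.Ventures.HodgeRepro2.T5HeckeRecurrenceTransport
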